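import Mathlib
import HarnessLib.Audit
import Summits.PneNP.PneNP.Theorems.PstarCrossCasePEmptyW1
import Summits.PneNP.PneNP.Theorems.PstarCrossBudget

/-!
# The blind free CROSS gate, node N1, step 4: the GENERIC configurations are empty — three good private edges of `D_p Δ D_q` and all private edges good contradict TOUCH (O2 / E1; prover-1 g22)

FRONTIER range-avoidance ladder, rung F-N3 (`stmt-PneNP-19007`), cell `pnp-ideate`; restricted-model proof complexity — nothing here bears on `P` versus `NP`.

Node N1 (`PstarCrossNodes.CrossCasePEmpty`: cross data with no real chord besides the two gate chords).  Assembly of steps 1–3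
(`PstarCrossCasePEmptyW2` / `…Toggle` / `…W1`) with the budget and TOUCH (`PstarCrossBudget`):

* `false_of_untouched` — if NO private tree edge is read by either constraint, the datum is contradictory (the budget `#(J₀∖N) + 3 ≤ 2 + 2·#Pv` supplies a
  private tree edge, TOUCH says it is read);
* **`false_of_three_good`** — if every private tree edge is GOOD (for every two private edges some switching set avoids both) and three distinct private
  tree edges lie in `D_p Δ D_q`, the datum is contradictory: good ⟹ controlled (step 1/2), the three have `c_j = 1` (step 2), so `q_{(0,1)} ∈ {0, q_{(1,0)}}`
  (step 3) and neither constraint reads any private edge;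
* `avail_of_A`, `avail_of_B`, `avail_of_C`, `avail_of_AB`, `avail_of_BC`, `avail_of_AC` — switching sets from one or two private edges of the right
  Venn classes at the right levels (with `avail_of_levels_zero`: at levels `(0,0)` EVERY private edge is good);
* **`false_of_levels_zero`** — hence at levels `(γ_p, γ_q) = (0, 0)` three private tree edges in `D_p Δ D_q` are already contradictory.
WHAT REMAINS OF N1 (for the successor; planner memo §14.42 "pins"): (a) levels `≠ (0,0)` where some private edge is NOT good — by the `avail_of_*`
lemmas this pins the private parts of the Venn classes to `≤ 2` edges (the OR-pin / bowtie-two-OR family, to be killed by the budget WITH the pin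
carriers counted); (b) fewer than three private edges in `D_p Δ D_q` (rank of `q` not known to be `≥ 6`; use `PstarRankRigidityFour.classification`
for `q_{(0,1)}` instead and count the product shapes).
-/

set_option linter.dupNamespace false -- `Summit.PneNP.PneNP.…`: summit = sub-problem name (D-0017 single-conjunct layout)

open Finset Module Literature.Computability.Complexity
open Summit.PneNP.PneNP.Theorems.PstarTyped (Typed)
open Summit.PneNP.PneNP.Theorems.PstarSALevel (varSet BoundaryExpanding SimpleOverlap)
open Summit.PneNP.PneNP.Theorems.PstarCentreFree (vars_mem_varSet)
open Summit.PneNP.PneNP.Theorems.PstarReadSumset (V2)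
open Summit.PneNP.PneNP.Theorems.PstarChordSystem (ChordSystem)
open Summit.PneNP.PneNP.Theorems.PstarChordBridgeTools
open Summit.PneNP.PneNP.Theorems.PstarChordBridge
open Summit.PneNP.PneNP.Theorems.PstarChordBridgeForcing (gam)
open Summit.PneNP.PneNP.Theorems.PstarChordBridgeBasis (qDir polarDir)
open Summit.PneNP.PneNP.Theorems.PstarCrossData (CrossData)
open Summit.PneNP.PneNP.Theorems.PstarCrossSystem
open Summit.PneNP.PneNP.Theorems.PstarCrossCorner (PrivEdge)
open Summit.PneNP.PneNP.Theorems.PstarCrossCornerReads (Switch)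
open Summit.PneNP.PneNP.Theorems.PstarCrossBudget (cross_budget cross_touch)
open Summit.PneNP.PneNP.Theorems.PstarCrossCasePEmptyW2
open Summit.PneNP.PneNP.Theorems.PstarCrossCasePEmptyToggle (Controlled cval controlled_of_good cval_eq_one_of_A cval_eq_one_of_B)
open Summit.PneNP.PneNP.Theorems.PstarCrossCasePEmptyW1 (qDir01_dichotomy w₁_untouched)

namespace Summit.PneNP.PneNP.Theorems.PstarCrossCasePEmptyGeneric

variable {n m : ℕ}

section

variable (I : LocalMap 4 n m) {r : ℕ} {B : BridgeData n m} {e_p e_q g₀ : Fin m}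

/-- In node N1 the chord set is `{e_p, e_q}`. -/
theorem N_eq (hD : CrossData I r B e_p e_q g₀) (hE : (B.N.erase e_q).erase e_p = ∅) : B.N = {e_p, e_q} := by
  have hpe : e_p ∈ B.N.erase e_q := mem_erase.2 ⟨hD.ne, hD.mem_p⟩
  rw [← insert_erase hD.mem_q, ← insert_erase hpe, hE, pair_comm]; rfl

/-- **No private tree edge unread by both constraints** (budget + TOUCH). -/
theorem false_of_untouched (hI : I.IsPure xorAndPred) (hB : BoundaryExpanding r I) (hD : CrossData I r B e_p e_q g₀)
    (hE : (B.N.erase e_q).erase e_p = ∅)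
    (h : ∀ π, PrivEdge I B π →
      (I.vars π 2 ∉ B.C₁ ∧ I.vars π 3 ∉ B.C₁) ∧ (I.vars π 2 ∉ B.C₂ ∧ I.vars π 3 ∉ B.C₂) ∧
      (∀ g ∈ B.G₁, I.vars g 2 ≠ I.vars π 2 ∧ I.vars g 3 ≠ I.vars π 2 ∧ I.vars g 2 ≠ I.vars π 3 ∧ I.vars g 3 ≠ I.vars π 3) ∧
      (∀ g ∈ B.G₂, I.vars g 2 ≠ I.vars π 2 ∧ I.vars g 3 ≠ I.vars π 2 ∧ I.vars g 2 ≠ I.vars π 3 ∧ I.vars g 3 ≠ I.vars π 3)) : False := by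
  classical
  obtain ⟨Pv, hPv, hpriv, hcount⟩ := cross_budget I hB hD
  have hN2 : B.N.card = 2 := by rw [N_eq I hD hE, card_pair hD.ne]
  rw [hN2] at hcount
  obtain ⟨π, hπ⟩ : Pv.Nonempty := by
    rw [← card_pos]; omega
  have hπF : π ∈ B.J₀ \ B.N := hPv hπ
  have hprivJ : ∀ j ∈ B.J₀, j ≠ π → I.vars π 2 ∉ varSet I j ∧ I.vars π 3 ∉ varSet I j :=
    fun j hj hne => hpriv π hπ j (mem_insert_of_mem hj) hne
  obtain ⟨hC₁, hC₂, hG₁, hG₂⟩ := h π ⟨hπF, hprivJ⟩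
  exact cross_touch I hI hD hπF hprivJ hC₁ hC₂ hG₁ hG₂

/-- **THE GENERIC CASE OF NODE N1 IS EMPTY.**  All private tree edges good and three distinct private tree edges in `D_p Δ D_q` contradict TOUCH. -/
theorem false_of_three_good (hI : I.IsPure xorAndPred) (hT : Typed I) (hS : SimpleOverlap I) (hB : BoundaryExpanding r I)
    (hD : CrossData I r B e_p e_q g₀) (hE : (B.N.erase e_q).erase e_p = ∅)
    (hgood : ∀ π, PrivEdge I B π → ∀ k, PrivEdge I B k → Avail I B e_p e_q {π, k})
    {j₁ j₂ j₃ : Fin m} (h₁ : PrivEdge I B j₁) (h₂ : PrivEdge I B j₂) (h₃ : PrivEdge I B j₃) (h12 : j₁ ≠ j₂) (h13 : j₁ ≠ j₃) (h23 : j₂ ≠ j₃)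
    (hΔ : ∀ j ∈ ({j₁, j₂, j₃} : Finset (Fin m)), (j ∈ B.D e_p ∧ j ∉ B.D e_q) ∨ (j ∉ B.D e_p ∧ j ∈ B.D e_q)) : False := by
  have hSR := singleRead_of_empty I hD hE
  have hctrl : ∀ π, PrivEdge I B π → Controlled I B π := fun π hπ => controlled_of_good I hI hT hD hSR hπ (hgood π hπ)
  have hc : ∀ j ∈ ({j₁, j₂, j₃} : Finset (Fin m)), PrivEdge I B j → cval I B j = 1 := by
    intro j hj hpj
    rcases hΔ j hj with ⟨hp, hq⟩ | ⟨hp, hq⟩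
    · exact cval_eq_one_of_A I hI hT hS hD hSR (hctrl j hpj) hp hq
    · exact cval_eq_one_of_B I hI hT hS hD hSR (hctrl j hpj) hp hq
  have hg := qDir01_dichotomy I hI hT hD hSR hE (hctrl j₁ h₁) (hctrl j₂ h₂) (hctrl j₃ h₃) h12 h13 h23
    (hc j₁ (by simp) h₁) (hc j₂ (by simp) h₂) (hc j₃ (by simp) h₃)
  refine false_of_untouched I hI hB hD hE fun π hπ => ?_
  obtain ⟨hC₁, hG₁⟩ := w₁_untouched I hI hT hS hD (hctrl π hπ) hg
  obtain ⟨hC₂, hG₂⟩ := w₂_untouched I hI hT hS hD hSR hπ (hgood π hπ)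
  exact ⟨hC₁, hC₂, hG₁, hG₂⟩

/-! ## Availability of switching sets from class counts -/

/-- Levels `(1,0)`: one private edge of `D_p ∖ D_q` outside `X` switches. -/
theorem avail_of_A (hp : gam B e_p = 1) (hq : gam B e_q = 0) {X : Finset (Fin m)} {a : Fin m} (ha : PrivEdge I B a) (hap : a ∈ B.D e_p)
    (haq : a ∉ B.D e_q) (haX : a ∉ X) : Avail I B e_p e_q X :=
  ⟨{a}, switch_single_A I ha hap haq hp hq, disjoint_singleton_left.2 haX⟩

/-- Levels `(0,1)`: one private edge of `D_q ∖ D_p` outside `X` switches. -/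
theorem avail_of_B (hp : gam B e_p = 0) (hq : gam B e_q = 1) {X : Finset (Fin m)} {b : Fin m} (hb : PrivEdge I B b) (hbp : b ∉ B.D e_p)
    (hbq : b ∈ B.D e_q) (hbX : b ∉ X) : Avail I B e_p e_q X :=
  ⟨{b}, switch_single_B I hb hbp hbq hp hq, disjoint_singleton_left.2 hbX⟩

/-- Levels `(1,1)`: one private edge of `D_p ∩ D_q` outside `X` switches. -/
theorem avail_of_C (hp : gam B e_p = 1) (hq : gam B e_q = 1) {X : Finset (Fin m)} {c : Fin m} (hc : PrivEdge I B c) (hcp : c ∈ B.D e_p)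
    (hcq : c ∈ B.D e_q) (hcX : c ∉ X) : Avail I B e_p e_q X :=
  ⟨{c}, switch_single_C I hc hcp hcq hp hq, disjoint_singleton_left.2 hcX⟩

/-- Levels `(1,1)`: a private edge of `D_p ∖ D_q` and one of `D_q ∖ D_p`, both outside `X`, switch. -/
theorem avail_of_AB (hp : gam B e_p = 1) (hq : gam B e_q = 1) {X : Finset (Fin m)} {a b : Fin m} (ha : PrivEdge I B a) (hb : PrivEdge I B b)
    (hap : a ∈ B.D e_p) (haq : a ∉ B.D e_q) (hbp : b ∉ B.D e_p) (hbq : b ∈ B.D e_q) (haX : a ∉ X) (hbX : b ∉ X) : Avail I B e_p e_q X := by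
  classical
  refine ⟨{a, b}, switch_pair_AB I ha hb hap haq hbp hbq hp hq, ?_⟩
  rw [Finset.disjoint_left]
  intro j hj
  rcases mem_insert.1 hj with rfl | hj
  · exact haX
  · rw [mem_singleton.1 hj]; exact hbX

/-- A general two-edge switching set: private edges `j ≠ k` with the right parities. -/
theorem switch_pair {j k : Fin m} (hj : PrivEdge I B j) (hk : PrivEdge I B k) (hjk : j ≠ k)
    (hp : gam B e_p + ((if j ∈ B.D e_p then 1 else 0) + (if k ∈ B.D e_p then 1 else 0)) = 0)
    (hq : gam B e_q + ((if j ∈ B.D e_q then 1 else 0) + (if k ∈ B.D e_q then 1 else 0)) = 0) : Switch I B e_p e_q {j, k} := by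
  classical
  have hcard : ∀ D : Finset (Fin m), ((D.filter fun l => l ∈ ({j, k} : Finset (Fin m))).card : ZMod 2) =
      (if j ∈ D then 1 else 0) + (if k ∈ D then 1 else 0) := by
    intro D
    have hsplit : (D.filter fun l => l ∈ ({j, k} : Finset (Fin m))) =
        (D.filter fun l => l = j) ∪ (D.filter fun l => l = k) := by
      ext l; simp only [mem_filter, mem_union, mem_insert, mem_singleton]; tauto
    have hdisj : Disjoint (D.filter fun l => l = j) (D.filter fun l => l = k) := by
      rw [Finset.disjoint_left]
      intro l hl hl'
      exact hjk ((mem_filter.1 hl).2.symm.trans (mem_filter.1 hl').2)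
    rw [hsplit, card_union_of_disjoint hdisj, Nat.cast_add, filter_eq', filter_eq']
    by_cases hjD : j ∈ D <;> by_cases hkD : k ∈ D <;> simp [hjD, hkD]
  refine ⟨fun l hl => by rcases mem_insert.1 hl with rfl | hl; exacts [hj, (mem_singleton.1 hl) ▸ hk], ?_, ?_⟩
  · rw [hcard]; exact hp
  · rw [hcard]; exact hq

/-- Levels `(1,0)`: a private edge of `D_p ∩ D_q` and one of `D_q ∖ D_p`, both outside `X`, switch. -/
theorem avail_of_BC (hp : gam B e_p = 1) (hq : gam B e_q = 0) {X : Finset (Fin m)} {b c : Fin m} (hb : PrivEdge I B b) (hc : PrivEdge I B c)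
    (hbp : b ∉ B.D e_p) (hbq : b ∈ B.D e_q) (hcp : c ∈ B.D e_p) (hcq : c ∈ B.D e_q) (hbX : b ∉ X) (hcX : c ∉ X) : Avail I B e_p e_q X := by
  classical
  have hbc : b ≠ c := fun h => hbp (h ▸ hcp)
  refine ⟨{b, c}, switch_pair I hb hc hbc (by rw [if_neg hbp, if_pos hcp, hp]; decide) (by rw [if_pos hbq, if_pos hcq, hq]; decide), ?_⟩
  rw [Finset.disjoint_left]
  intro j hj
  rcases mem_insert.1 hj with rfl | hj
  · exact hbX
  · rw [mem_singleton.1 hj]; exact hcX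

/-- Levels `(0,1)`: a private edge of `D_p ∩ D_q` and one of `D_p ∖ D_q`, both outside `X`, switch. -/
theorem avail_of_AC (hp : gam B e_p = 0) (hq : gam B e_q = 1) {X : Finset (Fin m)} {a c : Fin m} (ha : PrivEdge I B a) (hc : PrivEdge I B c)
    (hap : a ∈ B.D e_p) (haq : a ∉ B.D e_q) (hcp : c ∈ B.D e_p) (hcq : c ∈ B.D e_q) (haX : a ∉ X) (hcX : c ∉ X) : Avail I B e_p e_q X := by
  classical
  have hac : a ≠ c := fun h => haq (h ▸ hcq)
  refine ⟨{a, c}, switch_pair I ha hc hac (by rw [if_pos hap, if_pos hcp, hp]; decide) (by rw [if_neg haq, if_pos hcq, hq]; decide), ?_⟩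
  rw [Finset.disjoint_left]
  intro j hj
  rcases mem_insert.1 hj with rfl | hj
  · exact haX
  · rw [mem_singleton.1 hj]; exact hcX

/-- **Levels `(0,0)`: three private tree edges in `D_p Δ D_q` are contradictory** (every private edge is good by the empty switching set). -/
theorem false_of_levels_zero (hI : I.IsPure xorAndPred) (hT : Typed I) (hS : SimpleOverlap I) (hB : BoundaryExpanding r I)
    (hD : CrossData I r B e_p e_q g₀) (hE : (B.N.erase e_q).erase e_p = ∅) (hp : gam B e_p = 0) (hq : gam B e_q = 0)
    {j₁ j₂ j₃ : Fin m} (h₁ : PrivEdge I B j₁) (h₂ : PrivEdge I B j₂) (h₃ : PrivEdge I B j₃) (h12 : j₁ ≠ j₂) (h13 : j₁ ≠ j₃) (h23 : j₂ ≠ j₃)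
    (hΔ : ∀ j ∈ ({j₁, j₂, j₃} : Finset (Fin m)), (j ∈ B.D e_p ∧ j ∉ B.D e_q) ∨ (j ∉ B.D e_p ∧ j ∈ B.D e_q)) : False :=
  false_of_three_good I hI hT hS hB hD hE (fun _ _ _ _ => avail_of_levels_zero I hp hq _) h₁ h₂ h₃ h12 h13 h23 hΔ

end

end Summit.PneNP.PneNP.Theorems.PstarCrossCasePEmptyGeneric
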